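import Mathlib.Analysis.SpecialFunctions.Gamma.Deligne
import Mathlib.Analysis.SpecialFunctions.Gaussian.FourierTransform
import Mathlib.Analysis.SpecialFunctions.PolarCoord
import Mathlib.Analysis.Fourier.FourierTransformDeriv
import Mathlib.MeasureTheory.Integral.IntegralEqImproper
import Mathlib.MeasureTheory.Measure.Lebesgue.Integral
import HarnessLib

/-!
# Tate's local theory at the archimedean places: the special zeta functions of §2.5

Topic `NumberTheory/Automorphic`; namespace `Literature.NumberTheory.Automorphic.TateArchimedean`.
Theorems only (no definition, no named fact, no instance, no `sorry`), companion to the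
non-archimedean files `TateLocalFactors`, `TateLocalZetaShells`, `TateLocalSchwartzBruhat`,
`TateLocalFunctionalEquation`, `TateGaussSums`.

J. Tate, *Fourier analysis in number fields and Hecke's zeta-functions* (1950), in
Cassels–Fröhlich, *Algebraic Number Theory* (1967), Ch. XV, §2.5 "Computation of `ρ(c)` by special
`ζ`-functions" (PDF pp. 343–345 of the held copy): for each equivalence class of quasi-characters
`c` of `kˣ`, `k = ℝ` or `ℂ`, an explicit `f ∈ 𝔷` is given together with `f̂` and the local zeta
function `ζ(f, c) = ∫_{kˣ} f(α) c(α) d^×α` (§2.4, Def. 2.4.1) in closed form. These are the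
archimedean `Γ`-factors `Γ_ℝ(s) = π^{-s/2} Γ(s/2)` (Mathlib `Complex.Gammaℝ`) and
`Γ_ℂ(s) = 2 (2π)^{-s} Γ(s)` of every completed Hecke or Artin `L`-function of the tree
(`HeckeCharacter.archGammaFactor`, `ArtinRep.gammaFactor`, the factors
`Γ_ℝ(s + ν + ε)`, `Γ_ℂ(s + ν + |k|/2)` of `BookerKrishnamurthyConverse`). We prove, in Mathlib's
measure-theoretic vocabulary (Lebesgue measure `volume` on `ℝ` and on `ℂ ≅ ℝ²`):

* **`k` real** (p. 343: "`dα = dα/|α|`", `f(ξ) = e^{-πξ²}`, `f_±(ξ) = ξ e^{-πξ²}`):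
  `integral_Ioi_cpow_mul_exp_neg_pi_sq` —
  `∫₀^∞ α^{s-1} e^{-πα²} dα = ½ π^{-s/2} Γ(s/2)` (`re s > 0`);
  `zeta_real_trivial` — **`ζ(f, |·|^s) = ∫_{-∞}^{∞} e^{-πα²} |α|^s dα/|α| = π^{-s/2} Γ(s/2) = Γ_ℝ(s)`**;
  `zeta_real_sign` — **`ζ(f_±, ±|·|^s) = ∫ α e^{-πα²} (sign α) |α|^s dα/|α| = π^{-(s+1)/2} Γ((s+1)/2)`**;
  `fourier_real_gaussian` — `f̂ = f`, and `fourier_real_sign` — the transform of `f_±` is `-i f_±`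
  for Mathlib's kernel `e^{-2πi ξη}` (Tate's `Λ(ξ) = -ξ` gives the kernel `e^{+2πi ξη}` and hence his
  `f̂_± = +i f_±`, p. 343; the two conventions differ by `ξ ↦ -ξ`).
* **`k` complex** (p. 344: "`|α| = r²`", "`dξ = 2|dx dy|`", "`dα = dξ/|α| = (2/r)|dr dθ|`",
  `c_n(re^{iθ}) = e^{inθ}`, `f_n(ξ) = ξ̄^{|n|} e^{-2π ξξ̄}` for `n ≥ 0`):
  `zeta_complex` — **`ζ(f_n, c_n|·|^s) = ∫_ℂ f_n(α) c_n(α) |α|^s dα = (2π)^{1-s-n/2} Γ(s + n/2)`**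
  for `n ≥ 0` and `re s > -n/2`, computed as on p. 345:
  `∫₀^∞ ∫₀^{2π} r^{2(s-1)+n} e^{-2πr²} 2r dr dθ = 2π ∫₀^∞ u^{(s-1)+n/2} e^{-2πu} du`.
  **Remark on the printed formula.** P. 345 prints the value as `(2π)^{(1-s)+|n|/2} Γ(s + |n|/2)`;
  evaluating the last integral (`∫₀^∞ u^{a-1} e^{-2πu} du = (2π)^{-a} Γ(a)` with `a = s + |n|/2`)
  gives the exponent `1 - s - |n|/2`, which is what is proved here (e.g. `n = 2`, `s = 1`:
  `∫_ℂ r² e^{-2πr²} · r² · (2/r) dr dθ = 1/(2π)`, not `2π`). The quotient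
  `ρ(c_n|·|^s) = (-i)^{|n|} (2π)^{1-s} Γ(s + |n|/2) / ((2π)^s Γ(1 - s + |n|/2))` printed on p. 345 is
  unaffected, the same power of `2π` cancelling from `ζ(f_n, ·)` and `ζ(f̂_n, ·)`.

The case `n ≤ 0` of the complex computation is the complex conjugate of the case `n ≥ 0` and is not
repeated; the Fourier transforms `f̂_n = i^{|n|} f_{-n}` on `ℂ` (p. 344, by induction with the
operator `D = (4πi)⁻¹(∂_x + i∂_y)`) and the local functional equation for *all* `f ∈ 𝔷` at the
archimedean places (Lemma 2.4.2, Thm. 2.4.1) are deliberately NOT here.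

## References

* J. Tate, *Fourier analysis in number fields and Hecke's zeta-functions* (thesis, 1950), in
  J. W. S. Cassels, A. Fröhlich (eds.), *Algebraic Number Theory* (1967), Ch. XV, §2.4
  (Def. 2.4.1, Thm. 2.4.1), §2.5 (PDF pp. 343–345). [TateThesis1967] [CasselsFrohlichANT1967]

## Mathlib

`integral_cpow_mul_exp_neg_mul_Ioi` (`∫₀^∞ t^{a-1} e^{-rt} dt = r^{-a} Γ(a)`),
`MeasureTheory.integral_comp_rpow_Ioi` (the substitution `u = α²`), `integral_comp_abs`,
`Complex.integral_comp_polarCoord_symm`, `setIntegral_prod_mul` (polar coordinates on `ℂ`),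
`fourier_gaussian_pi`, `Real.deriv_fourier` (transform of `ξ f(ξ)`), `Complex.Gammaℝ`.
-/

noncomputable section

open MeasureTheory Set Real Complex
open scoped FourierTransform Topology

namespace Literature.NumberTheory.Automorphic.TateArchimedean

/-! ### Powers of positive reals with complex exponents -/

/-- `((x²) : ℂ) ^ w = (x : ℂ) ^ (2w)` for `x > 0` (no branch issue: `log x` is real). [folklore] -/
theorem ofReal_sq_cpow {x : ℝ} (hx : 0 < x) (w : ℂ) :
    (((x ^ 2 : ℝ)) : ℂ) ^ w = (x : ℂ) ^ (2 * w) := by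
  have him : (Complex.log x * 2).im = 0 := by
    rw [← Complex.ofReal_log hx.le, ← Complex.ofReal_ofNat, ← Complex.ofReal_mul, Complex.ofReal_im]
  rw [Complex.cpow_mul _ (by rw [him]; exact neg_lt_zero.mpr Real.pi_pos)
      (by rw [him]; exact Real.pi_pos.le), Complex.ofReal_pow]
  norm_cast

/-- `x^{s-1} = x · (x²)^{s/2 - 1}` for `x > 0`. [folklore] -/
theorem cpow_sub_one_eq_mul_sq_cpow {x : ℝ} (hx : 0 < x) (s : ℂ) :
    (x : ℂ) ^ (s - 1) = (x : ℂ) * (((x ^ 2 : ℝ)) : ℂ) ^ (s / 2 - 1) := by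
  have hx0 : (x : ℂ) ≠ 0 := Complex.ofReal_ne_zero.mpr hx.ne'
  rw [ofReal_sq_cpow hx, show (2 : ℂ) * (s / 2 - 1) = (s - 1) - 1 by ring]
  conv_rhs => rw [Complex.cpow_sub _ _ hx0, Complex.cpow_one, ← mul_div_assoc, mul_div_cancel_left₀ _ hx0]

/-! ### `k` real -/

/-- **The half-line Mellin transform of the Gaussian** (Tate 1950, §2.5, `k` real, p. 343:
"`2 ∫₀^∞ e^{-πα²} α^{s-1} dα = π^{-s/2} Γ(s/2)`"): for `re s > 0`,
`∫₀^∞ α^{s-1} e^{-πα²} dα = ½ π^{-s/2} Γ(s/2)` — the substitution `u = α²` and Euler's integral.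
[cite: TateThesis1967, §2.5 (k real), Cassels–Fröhlich p. 343] -/
theorem integral_Ioi_cpow_mul_exp_neg_pi_sq {s : ℂ} (hs : 0 < s.re) :
    ∫ x in Ioi (0 : ℝ), (x : ℂ) ^ (s - 1) * cexp (-π * (x : ℂ) ^ 2) =
      1 / 2 * (π : ℂ) ^ (-s / 2) * Complex.Gamma (s / 2) := by
  -- the substitution `u = x²`
  have key := integral_comp_rpow_Ioi
    (fun u : ℝ => (1 / 2 : ℂ) * ((u : ℂ) ^ (s / 2 - 1) * cexp (-(π * (u : ℂ))))) two_ne_zero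
  have hL : EqOn (fun x : ℝ => (|(2 : ℝ)| * x ^ ((2 : ℝ) - 1)) •
      ((1 / 2 : ℂ) * (((x ^ (2 : ℝ) : ℝ) : ℂ) ^ (s / 2 - 1) * cexp (-(π * ((x ^ (2 : ℝ) : ℝ) : ℂ))))))
      (fun x : ℝ => (x : ℂ) ^ (s - 1) * cexp (-π * (x : ℂ) ^ 2)) (Ioi 0) := by
    intro x hx
    rw [mem_Ioi] at hx
    simp only []
    rw [abs_of_pos two_pos, show (2 : ℝ) - 1 = 1 by norm_num, Real.rpow_one, Real.rpow_two,
      Complex.real_smul, cpow_sub_one_eq_mul_sq_cpow hx, Complex.ofReal_mul, Complex.ofReal_pow]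
    push_cast
    ring
  rw [← setIntegral_congr_fun measurableSet_Ioi hL, key, integral_const_mul,
    integral_cpow_mul_exp_neg_mul_Ioi (by simpa using half_pos hs) Real.pi_pos]
  -- `(1/π)^{s/2} = π^{-s/2}`
  rw [one_div (π : ℂ), Complex.inv_cpow _ _ (by
      rw [Complex.arg_ofReal_of_nonneg Real.pi_pos.le]; exact Real.pi_ne_zero.symm),
    ← Complex.cpow_neg, neg_div, mul_assoc]

/-- The even-function doubling `∫_{-∞}^{∞} F(|x|) dx = 2 ∫₀^∞ F(x) dx` for complex-valued `F`
(Mathlib's `integral_comp_abs` is stated for real-valued functions; same proof). [folklore] -/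
theorem integral_comp_abs_complex {F : ℝ → ℂ} :
    ∫ x : ℝ, F |x| = 2 * ∫ x in Ioi (0 : ℝ), F x := by
  have eq : ∫ x : ℝ in Ioi 0, F |x| = ∫ x : ℝ in Ioi 0, F x := by
    refine setIntegral_congr_fun measurableSet_Ioi (fun _ hx => ?_)
    rw [abs_eq_self.mpr (le_of_lt (by exact hx))]
  by_cases hf : IntegrableOn (fun x => F |x|) (Ioi 0)
  · have int_Iic : IntegrableOn (fun x ↦ F |x|) (Iic 0) := by
      rw [← Measure.map_neg_eq_self (volume : Measure ℝ)]
      let m : MeasurableEmbedding fun x : ℝ => -x := (Homeomorph.neg ℝ).measurableEmbedding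
      rw [m.integrableOn_map_iff]
      simp_rw [Function.comp_def, abs_neg, neg_preimage, neg_Iic, neg_zero]
      exact Iff.mpr integrableOn_Ici_iff_integrableOn_Ioi hf
    calc
      _ = (∫ x in Iic 0, F |x|) + ∫ x in Ioi 0, F |x| := by
        rw [← setIntegral_union (Iic_disjoint_Ioi le_rfl) measurableSet_Ioi int_Iic hf,
          Iic_union_Ioi, Measure.restrict_univ]
      _ = 2 * ∫ x in Ioi 0, F x := by
        rw [two_mul, eq]
        congr! 1
        rw [← neg_zero, ← integral_comp_neg_Iic, neg_zero]
        refine setIntegral_congr_fun measurableSet_Iic (fun _ hx => ?_)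
        rw [abs_eq_neg_self.mpr (by exact hx)]
  · have : ¬ Integrable (fun x => F |x|) := by
      contrapose hf
      exact hf.integrableOn
    rw [← eq, integral_undef hf, integral_undef this, mul_zero]

/-- **Tate's `ζ(f, |·|^s)` at a real place** (§2.5, `k` real, p. 343): with `f(ξ) = e^{-πξ²}` and
`d^×α = dα/|α|`,
`ζ(f, |·|^s) = ∫_{-∞}^{∞} e^{-πα²} |α|^s dα/|α| = 2 ∫₀^∞ e^{-πα²} α^{s-1} dα = π^{-s/2} Γ(s/2)`,
i.e. Mathlib's `Γ_ℝ(s)` (`Complex.Gammaℝ`), for `re s > 0` (Lemma 2.4.1: quasi-characters of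
exponent `> 0`). The integrand is written `|α|^{s-1} e^{-πα²}`.
[cite: TateThesis1967, §2.5 (k real), Cassels–Fröhlich p. 343] -/
theorem zeta_real_trivial {s : ℂ} (hs : 0 < s.re) :
    ∫ x : ℝ, ((|x| : ℝ) : ℂ) ^ (s - 1) * cexp (-π * (x : ℂ) ^ 2) = Complex.Gammaℝ s := by
  have hsq : ∀ x : ℝ, (x : ℂ) ^ 2 = ((|x| : ℝ) : ℂ) ^ 2 := fun x => by
    rw [← Complex.ofReal_pow, ← Complex.ofReal_pow, sq_abs]
  have hfun : (fun x : ℝ => ((|x| : ℝ) : ℂ) ^ (s - 1) * cexp (-π * (x : ℂ) ^ 2)) =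
      fun x : ℝ => (fun y : ℝ => (y : ℂ) ^ (s - 1) * cexp (-π * (y : ℂ) ^ 2)) |x| := by
    funext x
    simp only []
    rw [hsq x]
  rw [hfun, integral_comp_abs_complex (F := fun x : ℝ => (x : ℂ) ^ (s - 1) * cexp (-π * (x : ℂ) ^ 2)),
    integral_Ioi_cpow_mul_exp_neg_pi_sq hs, Complex.Gammaℝ_def]
  ring

/-- **Tate's `ζ(f_±, ±|·|^s)` at a real place** (§2.5, `k` real, p. 343): with
`f_±(ξ) = ξ e^{-πξ²}` and the sign character,
`ζ(f_±, ±|·|^s) = ∫_{-∞}^{∞} α e^{-πα²} (sign α) |α|^s dα/|α| = 2 ∫₀^∞ e^{-πα²} α^s dα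
  = π^{-(s+1)/2} Γ((s+1)/2)` (`= Γ_ℝ(s + 1)`), for `re s > 0` (indeed for `re s > -1`). The
integrand is written `α · sign α · |α|^{s-1} e^{-πα²}` (`= |α|^s e^{-πα²}`).
[cite: TateThesis1967, §2.5 (k real), Cassels–Fröhlich p. 343] -/
theorem zeta_real_sign {s : ℂ} (hs : -1 < s.re) :
    ∫ x : ℝ, (x : ℂ) * (SignType.sign x : ℂ) * ((|x| : ℝ) : ℂ) ^ (s - 1) * cexp (-π * (x : ℂ) ^ 2) =
      (π : ℂ) ^ (-(s + 1) / 2) * Complex.Gamma ((s + 1) / 2) := by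
  have hs' : 0 < (s + 1).re := by rw [Complex.add_re, Complex.one_re]; linarith
  -- `α · sign α · |α|^{s-1} = |α|^{(s+1)-1}` away from `α = 0`
  have hae : (fun x : ℝ => (x : ℂ) * (SignType.sign x : ℂ) * ((|x| : ℝ) : ℂ) ^ (s - 1) *
      cexp (-π * (x : ℂ) ^ 2)) =ᵐ[volume]
      fun x : ℝ => ((|x| : ℝ) : ℂ) ^ (s + 1 - 1) * cexp (-π * (x : ℂ) ^ 2) := by
    have h0 : ∀ᵐ x : ℝ ∂volume, x ≠ 0 := by
      simp [ae_iff]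
    filter_upwards [h0] with x hx
    have hx' : (0 : ℝ) < |x| := abs_pos.mpr hx
    have habs : ((|x| : ℝ) : ℂ) ≠ 0 := Complex.ofReal_ne_zero.mpr hx'.ne'
    have hxs : (x : ℂ) * (SignType.sign x : ℂ) = ((|x| : ℝ) : ℂ) := by
      rcases lt_or_gt_of_ne hx with h | h
      · rw [_root_.sign_neg h, abs_of_neg h, SignType.coe_neg_one]; push_cast; ring
      · rw [_root_.sign_pos h, abs_of_pos h, SignType.coe_one, mul_one]
    rw [hxs, add_sub_cancel_right, show s = (s - 1) + 1 by ring, Complex.cpow_add _ _ habs,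
      Complex.cpow_one]
    ring_nf
  rw [integral_congr_ae hae, zeta_real_trivial hs', Complex.Gammaℝ_def, neg_add]

/-- **`f̂ = f` for `f(ξ) = e^{-πξ²}`** (§2.5, `k` real, p. 343: "`∫ e^{-πη² + 2πiξη} dη = e^{-πξ²}`";
for an even function Tate's kernel `e^{+2πiξη}` and Mathlib's `e^{-2πiξη}` give the same transform).
[cite: TateThesis1967, §2.5 (k real), Cassels–Fröhlich p. 343] -/
theorem fourier_real_gaussian :
    𝓕 (fun x : ℝ => cexp (-π * (x : ℂ) ^ 2)) = fun ξ : ℝ => cexp (-π * (ξ : ℂ) ^ 2) := by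
  have h := fourier_gaussian_pi (b := 1) (by simp)
  simp only [mul_one, Complex.one_cpow, div_one, ne_eq, one_ne_zero, not_false_eq_true,
    div_self, one_mul] at h
  exact h

/-- **The transform of `f_±(ξ) = ξ e^{-πξ²}`** (§2.5, `k` real, p. 343: "obtained by applying the
operation `(2πi)⁻¹ d/dξ` to the first" identity): for Mathlib's kernel `e^{-2πiξη}`,
`𝓕(f_±)(ξ) = -i ξ e^{-πξ²}`; with Tate's kernel `e^{+2πiξη}` (`Λ(ξ) = -ξ`) this is his
`f̂_± = i f_±` after `ξ ↦ -ξ`. Proof: `(𝓕 f)' = 𝓕(-2πiη f)` (`Real.deriv_fourier`) and `𝓕 f = f`.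
[cite: TateThesis1967, §2.5 (k real), Cassels–Fröhlich p. 343] -/
theorem fourier_real_sign :
    𝓕 (fun x : ℝ => (x : ℂ) * cexp (-π * (x : ℂ) ^ 2)) =
      fun ξ : ℝ => -Complex.I * ξ * cexp (-π * (ξ : ℂ) ^ 2) := by
  set f : ℝ → ℂ := fun x => cexp (-π * (x : ℂ) ^ 2) with hf
  have hfi : Integrable f := by
    have := integrable_cexp_neg_mul_sq (b := (π : ℂ)) (by simpa using Real.pi_pos)
    exact this.congr (ae_of_all _ fun x => by simp only [hf, neg_mul])
  have hfi' : Integrable (fun x : ℝ => x • f x) := by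
    have := integrable_mul_cexp_neg_mul_sq (b := (π : ℂ)) (by simpa using Real.pi_pos)
    refine this.congr (Filter.Eventually.of_forall fun x => ?_)
    simp [hf, Complex.real_smul]
  -- `(𝓕 f)' = 𝓕 (-2πi η f)` and `𝓕 f = f`
  have hd := Real.deriv_fourier hfi hfi'
  rw [show 𝓕 f = f from fourier_real_gaussian] at hd
  -- the derivative of `f`
  have hderiv : deriv f = fun ξ : ℝ => -2 * π * ξ * cexp (-π * (ξ : ℂ) ^ 2) := by
    funext ξ
    have h1 : HasDerivAt (fun x : ℝ => -π * (x : ℂ) ^ 2) (-π * (2 * ξ)) ξ := by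
      have h := ((Complex.ofRealCLM.hasDerivAt (x := ξ)).pow 2).const_mul (-(π : ℂ))
      simpa using h
    have h2 := h1.cexp
    rw [hf, h2.deriv]
    ring
  rw [hderiv] at hd
  -- solve for `𝓕 (η f)`
  have hlin : 𝓕 (fun x : ℝ => (-2 * π * Complex.I * x) • f x) =
      (-2 * π * Complex.I) • 𝓕 (fun x : ℝ => (x : ℂ) * cexp (-π * (x : ℂ) ^ 2)) := by
    have e : (fun x : ℝ => (-2 * π * Complex.I * x) • f x) =
        (-2 * π * Complex.I : ℂ) • (fun x : ℝ => (x : ℂ) * cexp (-π * (x : ℂ) ^ 2)) := by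
      funext x
      simp only [hf, smul_eq_mul, Pi.smul_apply]
      ring
    rw [e]
    exact VectorFourier.fourierIntegral_const_smul _ _ _ _ _
  rw [hlin] at hd
  have hI : (-2 * π * Complex.I : ℂ) ≠ 0 := by
    simp [Real.pi_ne_zero, Complex.I_ne_zero]
  have := congrArg (fun g : ℝ → ℂ => (-2 * π * Complex.I : ℂ)⁻¹ • g) hd
  simp only [smul_smul, inv_mul_cancel₀ hI, one_smul] at this
  rw [← this]
  funext ξ
  simp only [Pi.smul_apply, smul_eq_mul]
  field_simp
  ring_nf
  rw [Complex.I_sq]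
  ring

/-- **`ρ(|·|^s) = 2^{1-s} π^{-s} cos(πs/2) Γ(s)`** (§2.5, `k` real, p. 344, "Explicit Expressions for
`ρ(c)`": `ρ(|·|^s) = π^{-s/2}Γ(s/2) / (π^{-(1-s)/2}Γ((1-s)/2))`, "the second form follows from
elementary `Γ`-function identities"): the quotient `Γ_ℝ(s)/Γ_ℝ(1-s)` of `zeta_real_trivial` at `s`
and at `1 - s` (`f̂ = f`), through Mathlib's reflection/duplication formula
`Complex.Gammaℝ_div_Gammaℝ_one_sub`, away from the poles `s = -1, -3, -5, …` of the left side.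
[cite: TateThesis1967, §2.5 (k real), Cassels–Fröhlich p. 344] -/
theorem rho_real_trivial {s : ℂ} (hs : ∀ n : ℕ, s ≠ -(2 * n + 1)) :
    Complex.Gammaℝ s / Complex.Gammaℝ (1 - s) =
      (2 : ℂ) ^ (1 - s) * (π : ℂ) ^ (-s) * Complex.cos (π * s / 2) * Complex.Gamma s := by
  have h2 : (2 : ℂ) ^ (1 - s) = 2 * 2 ^ (-s) := by
    rw [sub_eq_add_neg, Complex.cpow_add _ _ (two_ne_zero' ℂ), Complex.cpow_one]
  rw [Complex.Gammaℝ_div_Gammaℝ_one_sub hs, Complex.Gammaℂ_def,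
    show (2 : ℂ) * (π : ℂ) = ((2 : ℝ) : ℂ) * (π : ℂ) by norm_num,
    Complex.mul_cpow_ofReal_nonneg two_pos.le Real.pi_pos.le, Complex.ofReal_ofNat, h2]
  ring

/-- **`ρ(±|·|^s) = -i 2^{1-s} π^{-s} sin(πs/2) Γ(s)`** (§2.5, `k` real, p. 344): by `zeta_real_sign`
and `f̂_± = i f_±` (Tate's kernel), `ρ(±|·|^s) = π^{-(s+1)/2}Γ((s+1)/2) / (i π^{-(2-s)/2}Γ((2-s)/2))
= -i · Γ_ℝ(s+1)/Γ_ℝ(2-s)`; the `Γ`-quotient is `2^{1-s} π^{-s} sin(πs/2) Γ(s)` (Mathlib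
`Complex.inv_Gammaℝ_two_sub`), away from `s = 0, -1, -2, …`. We state the `Γ`-identity; the factor
`-i` (resp. `+i` for Mathlib's Fourier kernel, `fourier_real_sign`) is the quotient of the constants
in `f̂_±`. [cite: TateThesis1967, §2.5 (k real), Cassels–Fröhlich p. 344] -/
theorem rho_real_sign {s : ℂ} (hs : ∀ n : ℕ, s ≠ -n) :
    Complex.Gammaℝ (s + 1) / Complex.Gammaℝ (2 - s) =
      (2 : ℂ) ^ (1 - s) * (π : ℂ) ^ (-s) * Complex.sin (π * s / 2) * Complex.Gamma s := by
  have h1 : Complex.Gammaℝ (s + 1) ≠ 0 := by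
    rw [Ne, Complex.Gammaℝ_eq_zero_iff, not_exists]
    intro n h
    apply hs (2 * n + 1)
    push_cast
    linear_combination h
  have h2 : (2 : ℂ) ^ (1 - s) = 2 * 2 ^ (-s) := by
    rw [sub_eq_add_neg, Complex.cpow_add _ _ (two_ne_zero' ℂ), Complex.cpow_one]
  rw [div_eq_mul_inv, Complex.inv_Gammaℝ_two_sub hs, Complex.Gammaℂ_def,
    show (2 : ℂ) * (π : ℂ) = ((2 : ℝ) : ℂ) * (π : ℂ) by norm_num,
    Complex.mul_cpow_ofReal_nonneg two_pos.le Real.pi_pos.le, Complex.ofReal_ofNat, h2]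
  field_simp

/-! ### `k` complex -/

/-- `f_n(α) c_n(α) = r^n` off `α = 0` (p. 345: "`f_n(α) = r^{|n|} e^{-inθ} e^{-2πr²}`,
`c_n(α) = e^{inθ}`"): `ᾱ^n (α/|α|)^n = |α|^n`. [folklore] -/
theorem conj_pow_mul_div_norm_pow {z : ℂ} (hz : z ≠ 0) (n : ℕ) :
    (starRingEnd ℂ z) ^ n * (z / (‖z‖ : ℂ)) ^ n = ((‖z‖ ^ n : ℝ) : ℂ) := by
  have hz' : (‖z‖ : ℂ) ≠ 0 := Complex.ofReal_ne_zero.mpr (norm_ne_zero_iff.mpr hz)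
  rw [← mul_pow, mul_div_assoc', Complex.conj_mul', Complex.ofReal_pow, sq, mul_div_assoc,
    div_self hz', mul_one]

/-- The radial integral behind `ζ(f_n, c_n|·|^s)` (p. 345, the substitution `u = r²`):
`∫₀^∞ r · r^n e^{-2πr²} (r²)^{s-1} · 2 dr = ∫₀^∞ u^{s + n/2 - 1} e^{-2πu} du = (2π)^{-(s+n/2)} Γ(s + n/2)`
for `re (s + n/2) > 0`. [cite: TateThesis1967, §2.5 (k complex), Cassels–Fröhlich p. 345] -/
theorem integral_Ioi_radial (n : ℕ) {s : ℂ} (hs : 0 < (s + n / 2).re) :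
    ∫ r in Ioi (0 : ℝ), (r : ℂ) * (((r ^ n : ℝ)) : ℂ) * cexp (-2 * π * (r : ℂ) ^ 2) *
        (((r ^ 2 : ℝ)) : ℂ) ^ (s - 1) * 2 =
      (1 / (2 * π) : ℂ) ^ (s + n / 2) * Complex.Gamma (s + n / 2) := by
  have key := integral_comp_rpow_Ioi
    (fun u : ℝ => (u : ℂ) ^ (s + n / 2 - 1) * cexp (-((2 * π) * (u : ℂ)))) two_ne_zero
  have hL : EqOn (fun r : ℝ => (|(2 : ℝ)| * r ^ ((2 : ℝ) - 1)) •
      ((((r ^ (2 : ℝ) : ℝ)) : ℂ) ^ (s + n / 2 - 1) * cexp (-((2 * π) * (((r ^ (2 : ℝ) : ℝ)) : ℂ)))))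
      (fun r : ℝ => (r : ℂ) * (((r ^ n : ℝ)) : ℂ) * cexp (-2 * π * (r : ℂ) ^ 2) *
        (((r ^ 2 : ℝ)) : ℂ) ^ (s - 1) * 2) (Ioi 0) := by
    intro r hr
    rw [mem_Ioi] at hr
    have hr0 : (((r ^ 2 : ℝ)) : ℂ) ≠ 0 := Complex.ofReal_ne_zero.mpr (pow_pos hr 2).ne'
    have hn : (((r ^ n : ℝ)) : ℂ) = (((r ^ 2 : ℝ)) : ℂ) ^ ((n : ℂ) / 2) := by
      rw [ofReal_sq_cpow hr, mul_div_cancel₀ _ (two_ne_zero' ℂ), Complex.cpow_natCast,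
        Complex.ofReal_pow]
    simp only []
    rw [abs_of_pos two_pos, show (2 : ℝ) - 1 = 1 by norm_num, Real.rpow_one, Real.rpow_two,
      Complex.real_smul, hn, show s + (n : ℂ) / 2 - 1 = (n : ℂ) / 2 + (s - 1) by ring,
      Complex.cpow_add _ _ hr0]
    push_cast
    ring
  rw [← setIntegral_congr_fun measurableSet_Ioi hL, key]
  have h := integral_cpow_mul_exp_neg_mul_Ioi hs Real.two_pi_pos
  push_cast at h
  exact h

/-- **Tate's `ζ(f_n, c_n|·|^s)` at a complex place** (§2.5, `k` complex, pp. 344–345): with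
`|α| = r²` the normalised absolute value, `dξ = 2 dx dy`, `d^×α = dξ/|α|`, the characters
`c_n(re^{iθ}) = e^{inθ}` and `f_n(ξ) = ξ̄^n e^{-2π ξξ̄}` (`n ≥ 0`),
`ζ(f_n, c_n|·|^s) = ∫_ℂ f_n(α) c_n(α) |α|^s d^×α = ∫₀^∞ ∫₀^{2π} r^{2(s-1)+n} e^{-2πr²} 2r dr dθ
  = 2π ∫₀^∞ u^{(s-1)+n/2} e^{-2πu} du = (2π)^{1-s-n/2} Γ(s + n/2)`
(the last exponent is printed `(1-s)+|n|/2` on p. 345; see the module docstring), for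
`re (s + n/2) > 0`. Here the integral is over `ℂ` with Lebesgue measure `dx dy`, the integrand being
`f_n(α) c_n(α) · (r²)^{s-1} · 2` (`|α|^s d^×α = (r²)^{s-1} · 2 dx dy`), in polar coordinates
(`Complex.integral_comp_polarCoord_symm`).
[cite: TateThesis1967, §2.5 (k complex), Cassels–Fröhlich pp. 344–345] -/
theorem zeta_complex (n : ℕ) {s : ℂ} (hs : 0 < (s + n / 2).re) :
    ∫ z : ℂ, (starRingEnd ℂ z) ^ n * (z / (‖z‖ : ℂ)) ^ n * cexp (-2 * π * (‖z‖ : ℂ) ^ 2) *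
        (((‖z‖ ^ 2 : ℝ)) : ℂ) ^ (s - 1) * 2 =
      (2 * π : ℂ) ^ (1 - s - n / 2) * Complex.Gamma (s + n / 2) := by
  -- the radial weight
  set H : ℝ → ℂ := fun r => (((r ^ n : ℝ)) : ℂ) * cexp (-2 * π * (r : ℂ) ^ 2) *
    (((r ^ 2 : ℝ)) : ℂ) ^ (s - 1) * 2 with hH
  -- `f_n c_n = r^n` almost everywhere
  have hae : (fun z : ℂ => (starRingEnd ℂ z) ^ n * (z / (‖z‖ : ℂ)) ^ n *
      cexp (-2 * π * (‖z‖ : ℂ) ^ 2) * (((‖z‖ ^ 2 : ℝ)) : ℂ) ^ (s - 1) * 2) =ᵐ[volume]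
      fun z : ℂ => H ‖z‖ := by
    have h0 : ∀ᵐ z : ℂ ∂volume, z ≠ 0 := by simp [ae_iff]
    filter_upwards [h0] with z hz
    rw [conj_pow_mul_div_norm_pow hz, hH]
  rw [integral_congr_ae hae]
  -- polar coordinates
  rw [← Complex.integral_comp_polarCoord_symm, polarCoord_target]
  have hpol : EqOn (fun p : ℝ × ℝ => p.1 • H ‖Complex.polarCoord.symm p‖)
      (fun p : ℝ × ℝ => ((p.1 : ℂ) * H p.1) * (fun _ : ℝ => (1 : ℂ)) p.2) (Ioi (0 : ℝ) ×ˢ Ioo (-π) π) := by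
    intro p hp
    simp only []
    rw [Complex.norm_polarCoord_symm, abs_of_pos (mem_prod.mp hp).1, Complex.real_smul, mul_one]
  rw [setIntegral_congr_fun (measurableSet_Ioi.prod measurableSet_Ioo) hpol, Measure.volume_eq_prod,
    setIntegral_prod_mul (fun r : ℝ => (r : ℂ) * H r) (fun _ : ℝ => (1 : ℂ))]
  -- the angular integral
  have hθ : ∫ _ in Ioo (-π) π, (1 : ℂ) = 2 * π := by
    rw [setIntegral_const, Measure.real, Real.volume_Ioo, Complex.real_smul, mul_one,
      ENNReal.toReal_ofReal (by linarith [Real.pi_pos])]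
    push_cast
    ring
  -- the radial integral
  have hrad : ∫ r in Ioi (0 : ℝ), (r : ℂ) * H r =
      (1 / (2 * π) : ℂ) ^ (s + n / 2) * Complex.Gamma (s + n / 2) := by
    rw [← integral_Ioi_radial n hs]
    refine setIntegral_congr_fun measurableSet_Ioi fun r _ => ?_
    simp only [hH]
    ring
  rw [hθ, hrad]
  -- `2π (2π)^{-(s + n/2)} = (2π)^{1 - s - n/2}`
  have h2π : (2 * π : ℂ) ≠ 0 := by exact_mod_cast Real.two_pi_pos.ne'
  rw [one_div, Complex.inv_cpow _ _ (by
      rw [show (2 * π : ℂ) = ((2 * π : ℝ) : ℂ) by push_cast; ring,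
        Complex.arg_ofReal_of_nonneg Real.two_pi_pos.le]; exact Real.pi_ne_zero.symm),
    ← Complex.cpow_neg, show (1 : ℂ) - s - n / 2 = 1 + -(s + n / 2) by ring,
    Complex.cpow_add _ _ h2π, Complex.cpow_one]
  ring

end Literature.NumberTheory.Automorphic.TateArchimedean
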